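import Mathlib
import Summits.AnomalousDissipation.AnomalousDissipation.Theses.DyadicWallCascade
import Summits.AnomalousDissipation.AnomalousDissipation.Theorems.HalfSpaceHierarchy.Negative.Reversible

/-!
# No columnar (z-independent) half-space hierarchy
# (negative lemma for the crux `DyadicWallCascade.HalfSpaceHierarchy`, stmt-AnomalousDissipation-18627)

Refuter file, Negative lane (D-0016), route `DyadicWallCascade` of `Summits/AnomalousDissipation`;
cdisprove seat `refuter-cdisprove-stmt-AnomalousDissipation-18627-0`.

`not_columnarHalfSpaceHierarchy`: the crux body (verbatim) together with "`V` does not depend on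
`z`" (`V X = V Y` whenever `X, Y` lie in the half-space over the same point `(x, y)`) is FALSE.

Mechanism: dilation invariance at height `1/2` and z-independence make the plane trace
`W(q) = V(q₁, q₂, 1)` invariant under halving, `W(q) = W(q/2) = ⋯ = W(q/2^k)`; continuity of `W`
at the single interior point `(0, 0, 1)` gives `W ≡ W(0)`; zero mass flux kills the vertical
component of that constant and the energy flux vanishes, against `F ≠ 0`.  Periodicity, the Euler
equation and the pressure are not used.  Reading for constructions: columnar jets `w(x, y) e₂`
ARE exact steady Euler flows with zero mass flux and `F = ½ ∫ w³ ≠ 0` at will — it is the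
self-similarity alone that empties the columnar class; any witness refines with depth in every
column (no leg of a design may cross all heights unchanged).
-/

open scoped BigOperators Topology InnerProductSpace
open Filter Set MeasureTheory

-- `Summit.<Summit>.<Problem>` is the tree's mandated summit-side namespace (CONVENTIONS §2); for this
-- single-conjunct summit the two coincide, so the duplicate is deliberate.
set_option linter.dupNamespace false

namespace Summit.AnomalousDissipation.AnomalousDissipation.Theorems

namespace HalfSpaceHierarchyNegative

/-- Volume of the flux square `[0,1]²`. [folklore] -/
theorem volReal_unitSq : (volume : Measure (ℝ × ℝ)).real (Set.Icc (0 : ℝ) 1 ×ˢ Set.Icc (0 : ℝ) 1) = 1 := by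
  simp only [Measure.real]
  rw [Measure.volume_eq_prod, Measure.prod_prod, Real.volume_Icc]
  simp

end HalfSpaceHierarchyNegative

open HalfSpaceHierarchyNegative in
/-- **No columnar half-space hierarchy**: the crux `DyadicWallCascade.HalfSpaceHierarchy` with the
extra clause "`V` is independent of `z`" has no witness (trace invariant under halving + continuity
at one point ⇒ constant trace ⇒ zero vertical trace by zero mass flux ⇒ `F = 0`). [folklore] -/
theorem not_columnarHalfSpaceHierarchy :
    ¬ (∃ (V : EuclideanSpace ℝ (Fin 3) → EuclideanSpace ℝ (Fin 3)) (Q : EuclideanSpace ℝ (Fin 3) → ℝ) (C F : ℝ),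
        (let H : Set (EuclideanSpace ℝ (Fin 3)) := {X | 0 < X 2}
         let e : Fin 3 → EuclideanSpace ℝ (Fin 3) := fun i => EuclideanSpace.single i (1 : ℝ)
         let pt : ℝ × ℝ → EuclideanSpace ℝ (Fin 3) := fun q => !₂[q.1, q.2, (1 : ℝ)]
         ContDiffOn ℝ ((⊤ : ℕ∞) : WithTop ℕ∞) V H ∧ ContDiffOn ℝ ((⊤ : ℕ∞) : WithTop ℕ∞) Q H ∧
         (∀ X ∈ H, ‖V X‖ ≤ C ∧ |Q X| ≤ C) ∧ (∀ X ∈ H, ∑ i : Fin 3, (fderiv ℝ V X (e i)) i = 0) ∧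
         (∀ X ∈ H, (fderiv ℝ V X) (V X) + gradient Q X = 0) ∧
         (∀ X ∈ H, V ((2 : ℝ) • X) = V X ∧ Q ((2 : ℝ) • X) = Q X) ∧
         (∀ X : EuclideanSpace ℝ (Fin 3), 1 ≤ X 2 → X 2 ≤ 2 →
            V (X + e 0) = V X ∧ V (X + e 1) = V X ∧ Q (X + e 0) = Q X ∧ Q (X + e 1) = Q X) ∧
         (∫ q in Set.Icc (0 : ℝ) 1 ×ˢ Set.Icc (0 : ℝ) 1, (V (pt q)) 2 = 0) ∧ F ≠ 0 ∧
         (∫ q in Set.Icc (0 : ℝ) 1 ×ˢ Set.Icc (0 : ℝ) 1, (V (pt q)) 2 * (‖V (pt q)‖ ^ 2 / 2 + Q (pt q)) = F)) ∧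
        (∀ X Y : EuclideanSpace ℝ (Fin 3), 0 < X 2 → 0 < Y 2 → X 0 = Y 0 → X 1 = Y 1 → V X = V Y)) := by
  rintro ⟨V, Q, C, F, hbody, hcol⟩
  simp only at hbody
  obtain ⟨hVs, _hQs, _hbdd, _hdiv, _hEul, hdil, _hper, hmass, hF, hflux⟩ := hbody
  -- the trace is invariant under halving
  have hhalf : ∀ q : ℝ × ℝ, V !₂[q.1, q.2, (1 : ℝ)] = V !₂[q.1 / 2, q.2 / 2, (1 : ℝ)] := by
    intro q
    have hX : (0 : ℝ) < (!₂[q.1 / 2, q.2 / 2, (1/2 : ℝ)] : EuclideanSpace ℝ (Fin 3)) 2 := by simp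
    have h1 := (hdil _ hX).1
    have h2 : ((2 : ℝ) • (!₂[q.1 / 2, q.2 / 2, (1/2 : ℝ)] : EuclideanSpace ℝ (Fin 3))) = !₂[q.1, q.2, (1 : ℝ)] := by
      ext i; fin_cases i <;> simp <;> ring
    rw [h2] at h1
    rw [h1]
    exact hcol _ _ (by simp) (by simp) (by simp) (by simp)
  have hiter : ∀ (k : ℕ) (q : ℝ × ℝ), V !₂[q.1, q.2, (1 : ℝ)] = V !₂[q.1 / 2 ^ k, q.2 / 2 ^ k, (1 : ℝ)] := by
    intro k
    induction k with
    | zero => intro q; simp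
    | succ k ih =>
      intro q
      rw [ih q, hhalf (q.1 / 2 ^ k, q.2 / 2 ^ k)]
      simp only [pow_succ, div_div]
  -- continuity of the trace at the origin
  have hcont : Continuous fun q : ℝ × ℝ => V !₂[q.1, q.2, (1 : ℝ)] :=
    hVs.continuousOn.comp_continuous HalfSpaceHierarchyNegative.continuous_pt (fun q => by simp)
  have hconst : ∀ q : ℝ × ℝ, V !₂[q.1, q.2, (1 : ℝ)] = V !₂[(0 : ℝ), (0 : ℝ), (1 : ℝ)] := by
    intro q
    have hseq : Tendsto (fun k : ℕ => ((q.1 / 2 ^ k, q.2 / 2 ^ k) : ℝ × ℝ)) atTop (𝓝 (0, 0)) := by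
      have h0 : Tendsto (fun k : ℕ => (1 / 2 : ℝ) ^ k) atTop (𝓝 0) :=
        tendsto_pow_atTop_nhds_zero_of_lt_one (by norm_num) (by norm_num)
      have ha : Tendsto (fun k : ℕ => q.1 / 2 ^ k) atTop (𝓝 0) := by
        have := h0.const_mul q.1
        simp only [mul_zero] at this
        refine this.congr fun k => ?_
        rw [one_div, inv_pow, div_eq_mul_inv]
      have hb : Tendsto (fun k : ℕ => q.2 / 2 ^ k) atTop (𝓝 0) := by
        have := h0.const_mul q.2
        simp only [mul_zero] at this
        refine this.congr fun k => ?_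
        rw [one_div, inv_pow, div_eq_mul_inv]
      exact ha.prodMk_nhds hb
    have hlim := (hcont.tendsto (0, 0)).comp hseq
    have hcst : (fun k : ℕ => V !₂[q.1 / 2 ^ k, q.2 / 2 ^ k, (1 : ℝ)]) = fun _ => V !₂[q.1, q.2, (1 : ℝ)] := by
      funext k; exact (hiter k q).symm
    have hlim' : Tendsto (fun _ : ℕ => V !₂[q.1, q.2, (1 : ℝ)]) atTop (𝓝 (V !₂[(0:ℝ), (0:ℝ), (1:ℝ)])) := by
      have : (fun k : ℕ => V !₂[((q.1 / 2 ^ k, q.2 / 2 ^ k) : ℝ × ℝ).1,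
          ((q.1 / 2 ^ k, q.2 / 2 ^ k) : ℝ × ℝ).2, (1 : ℝ)]) = fun _ => V !₂[q.1, q.2, (1 : ℝ)] := by
        funext k; exact (hiter k q).symm
      simpa [Function.comp_def, this] using hlim
    exact tendsto_nhds_unique tendsto_const_nhds hlim'
  simp_rw [hconst] at hmass hflux
  rw [setIntegral_const, HalfSpaceHierarchyNegative.volReal_unitSq, one_smul] at hmass
  rw [hmass] at hflux
  simp at hflux
  exact hF hflux.symm


end Summit.AnomalousDissipation.AnomalousDissipation.Theorems
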